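import Summits.Ventures.PercRepro.C025ProfileSecondRowDirectSum
import Summits.Ventures.PercRepro.C025ProfileGirthPaving
import Summits.Ventures.PercRepro.C025ProfileGirthRows

/-!
# THE SECOND ROW AND C-025's CORANK-2 DIAGONAL ON DIRECT SUMS OF PAVING MATROIDS (night-3 g23)

`proofs/NIGHT3-G23-SECONDROW.md` §0(I).  Every row of (Π) holds on every finite paving matroid (g21,
`PavingRows.profileIneq_of_paving`; the row `q = 0` on every matroid, `profileIneq_zero`), so by the direct-sum
theorem `SecondRow.profileIneq_disjointSum_second` the row `(q, ρ₁+ρ₂−1)` holds on `M ⊕ N` for paving `M`, `N` of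
ranks `ρ₁, ρ₂ ≥ 1` and every `q ≤ ρ₁+ρ₂−2`; at `q = ρ₁+ρ₂−2` the single row `(ρ−2, ρ−1)` is C-025 at the corank-2
diagonal `(ρ, ρ−2)` (`GirthRows.rls_of_profileIneq_rows`).  The theorem composes (the rank of `M ⊕ N` is `ρ₁ + ρ₂`,
`eRank_disjointSum_eq_coe`), so a third summand gives the rows of `(M ⊕ N) ⊕ K` and C-025's diagonal on direct sums
of three paving matroids.  A direct sum of two uniform matroids of ranks `≥ 2` is neither paving nor of girth
`≥ ρ−1` (a circuit of `ρᵢ+1 ≤ ρ−1` points), so this is a regime outside g21's.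
* `profileIneq_second_of_paving` — the rows `(j, ρ−1)`, `j ≤ ρ−2`, of a paving matroid;
* `profileIneq_disjointSum_second_of_paving`, **`rls_disjointSum_of_paving`** — two paving summands;
* `eRank_disjointSum_eq_coe`, `profileIneq_disjointSum_three_second`, **`rls_disjointSum_three_of_paving`** — three.
No `def`, no `instance`, no notation.  Axioms: standard.
-/

open scoped Matroid

namespace PercRepro

open Set Finset ThmH

namespace SecondRow

variable {α : Type} [DecidableEq α]


/-- The rows `(j, ρ−1)`, `j ≤ ρ−2`, of a paving matroid of rank `ρ` (the row `j = 0` on every matroid). -/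
theorem profileIneq_second_of_paving {M : Matroid α} [M.Finite]
    (hpav : ∀ C, M.IsCircuit C → M.eRank ≤ C.encard) (ρ : ℕ) (j : ℕ) (hj : j + 2 ≤ ρ) :
    Profile.ProfileIneq M j (ρ - 1) := by
  rcases Nat.eq_zero_or_pos j with rfl | hj0
  · exact profileIneq_zero (ρ - 1)
  · exact PavingRows.profileIneq_of_paving hpav j (ρ - 1) hj0 (by omega)

/-- **The second row of a direct sum of two paving matroids.** -/
theorem profileIneq_disjointSum_second_of_paving (M N : Matroid α) [M.Finite] [N.Finite]
    (h : Disjoint M.E N.E) [(M.disjointSum N h).Finite]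
    (hpavM : ∀ C, M.IsCircuit C → M.eRank ≤ C.encard) (hpavN : ∀ C, N.IsCircuit C → N.eRank ≤ C.encard)
    {ρ₁ ρ₂ : ℕ} (h₁ : M.eRank = (ρ₁ : ℕ∞)) (h₂ : N.eRank = (ρ₂ : ℕ∞)) (hρ₁ : 1 ≤ ρ₁) (hρ₂ : 1 ≤ ρ₂)
    (q : ℕ) (hq : q + 2 ≤ ρ₁ + ρ₂) :
    Profile.ProfileIneq (M.disjointSum N h) q (ρ₁ + ρ₂ - 1) :=
  profileIneq_disjointSum_second M N h h₁ h₂ hρ₁ hρ₂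
    (fun j hj => profileIneq_second_of_paving hpavM ρ₁ j hj)
    (fun j hj => profileIneq_second_of_paving hpavN ρ₂ j hj) q hq

/-- **C-025 at the corank-2 diagonal `(ρ, ρ−2)` on every direct sum of two paving matroids** of ranks `ρ₁, ρ₂ ≥ 1`
(`ρ = ρ₁ + ρ₂`): the single row `(ρ−2, ρ−1)` of the sum through the pointwise bridge. -/
theorem rls_disjointSum_of_paving (M N : Matroid α) [M.Finite] [N.Finite]
    (h : Disjoint M.E N.E) [(M.disjointSum N h).Finite]
    (hpavM : ∀ C, M.IsCircuit C → M.eRank ≤ C.encard) (hpavN : ∀ C, N.IsCircuit C → N.eRank ≤ C.encard)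
    {ρ₁ ρ₂ : ℕ} (h₁ : M.eRank = (ρ₁ : ℕ∞)) (h₂ : N.eRank = (ρ₂ : ℕ∞)) (hρ₁ : 1 ≤ ρ₁) (hρ₂ : 1 ≤ ρ₂) :
    ThmN.RLS (M.disjointSum N h) (ρ₁ + ρ₂) (ρ₁ + ρ₂ - 2) := by
  apply GirthRows.rls_of_profileIneq_rows
  intro u hu1 hu2
  have hu : u = ρ₁ + ρ₂ - 1 := by omega
  subst hu
  exact profileIneq_disjointSum_second_of_paving M N h hpavM hpavN h₁ h₂ hρ₁ hρ₂ (ρ₁ + ρ₂ - 2) (by omega)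


omit [DecidableEq α] in
/-- The rank of a disjoint sum, as a natural number. -/
theorem eRank_disjointSum_eq_coe {M N : Matroid α} (h : Disjoint M.E N.E) {ρ₁ ρ₂ : ℕ}
    (h₁ : M.eRank = (ρ₁ : ℕ∞)) (h₂ : N.eRank = (ρ₂ : ℕ∞)) :
    (M.disjointSum N h).eRank = ((ρ₁ + ρ₂ : ℕ) : ℕ∞) := by
  rw [eRank_disjointSum, h₁, h₂, Nat.cast_add]

/-- **The second row on a direct sum of three matroids** from the second rows of the summands. -/
theorem profileIneq_disjointSum_three_second (M N K : Matroid α) [M.Finite] [N.Finite] [K.Finite]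
    (h : Disjoint M.E N.E) [(M.disjointSum N h).Finite] (h' : Disjoint (M.disjointSum N h).E K.E)
    [((M.disjointSum N h).disjointSum K h').Finite]
    {ρ₁ ρ₂ ρ₃ : ℕ} (h₁ : M.eRank = (ρ₁ : ℕ∞)) (h₂ : N.eRank = (ρ₂ : ℕ∞)) (h₃ : K.eRank = (ρ₃ : ℕ∞))
    (hρ₁ : 1 ≤ ρ₁) (hρ₂ : 1 ≤ ρ₂) (hρ₃ : 1 ≤ ρ₃)
    (hM : ∀ j, j + 2 ≤ ρ₁ → Profile.ProfileIneq M j (ρ₁ - 1))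
    (hN : ∀ j, j + 2 ≤ ρ₂ → Profile.ProfileIneq N j (ρ₂ - 1))
    (hK : ∀ j, j + 2 ≤ ρ₃ → Profile.ProfileIneq K j (ρ₃ - 1))
    (q : ℕ) (hq : q + 2 ≤ ρ₁ + ρ₂ + ρ₃) :
    Profile.ProfileIneq ((M.disjointSum N h).disjointSum K h') q (ρ₁ + ρ₂ + ρ₃ - 1) :=
  profileIneq_disjointSum_second (M.disjointSum N h) K h' (eRank_disjointSum_eq_coe h h₁ h₂) h₃
    (by omega) hρ₃ (fun j hj => profileIneq_disjointSum_second M N h h₁ h₂ hρ₁ hρ₂ hM hN j hj) hK q hq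

/-- **C-025 at the corank-2 diagonal on every direct sum of three paving matroids** of ranks `≥ 1`. -/
theorem rls_disjointSum_three_of_paving (M N K : Matroid α) [M.Finite] [N.Finite] [K.Finite]
    (h : Disjoint M.E N.E) [(M.disjointSum N h).Finite] (h' : Disjoint (M.disjointSum N h).E K.E)
    [((M.disjointSum N h).disjointSum K h').Finite]
    (hpavM : ∀ C, M.IsCircuit C → M.eRank ≤ C.encard) (hpavN : ∀ C, N.IsCircuit C → N.eRank ≤ C.encard)
    (hpavK : ∀ C, K.IsCircuit C → K.eRank ≤ C.encard)
    {ρ₁ ρ₂ ρ₃ : ℕ} (h₁ : M.eRank = (ρ₁ : ℕ∞)) (h₂ : N.eRank = (ρ₂ : ℕ∞)) (h₃ : K.eRank = (ρ₃ : ℕ∞))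
    (hρ₁ : 1 ≤ ρ₁) (hρ₂ : 1 ≤ ρ₂) (hρ₃ : 1 ≤ ρ₃) :
    ThmN.RLS ((M.disjointSum N h).disjointSum K h') (ρ₁ + ρ₂ + ρ₃) (ρ₁ + ρ₂ + ρ₃ - 2) := by
  apply GirthRows.rls_of_profileIneq_rows
  intro u hu1 hu2
  have hu : u = ρ₁ + ρ₂ + ρ₃ - 1 := by omega
  subst hu
  exact profileIneq_disjointSum_three_second M N K h h' h₁ h₂ h₃ hρ₁ hρ₂ hρ₃
    (fun j hj => profileIneq_second_of_paving hpavM ρ₁ j hj)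
    (fun j hj => profileIneq_second_of_paving hpavN ρ₂ j hj)
    (fun j hj => profileIneq_second_of_paving hpavK ρ₃ j hj) (ρ₁ + ρ₂ + ρ₃ - 2) (by omega)

end SecondRow

end PercRepro
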